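import Summits.ValiantsHypothesis.ValiantsHypothesis.Theorems.BarrierLeverTransversalMinorLayoutsRankEightCellSeven
import Summits.ValiantsHypothesis.ValiantsHypothesis.Theorems.BarrierLeverTransversalMinorLayoutsEightFacesFourB

/-!
# Route BarrierLever — item `TransversalLayoutsRankLeEight` (stmt-ValiantsHypothesis-19933):
# the locked cell with eight faces at height 4, part A — tools, the star and the triangle graph

Helper file (`--supports stmt-ValiantsHypothesis-19933`; cell valiant-natproofs, rung V4, 𝒟-side of
door (c); seat val-np-p1 gen 8).  At `(h, r) = (4, 8)` the full side is the `4`-claw plus three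
distinct edges (`image_eq_of_claw_three_edges_of_le_two`): a `3`-STAR, a TRIANGLE GRAPH PLUS A POINT,
or a `4`-PATH.  This part: the degree formula `degree_of_claw_three_edges`, the column transports
for solid triangles / stars, and the cells
* `good_star_h4_r8` — star (class sizes `2, 4, 6`) against its only locked partner, the triangle
  graph plus a point (`lowerFamily_eight_no_degree_two_four`; certificate `triangleIso_v_star`
  read through the row/column swap);
* `good_triangleIso_h4_r8` — triangle graph plus a point (sizes `1, 3, 5, 7`) against the solid
  triangle or the star (`lowerFamily_eight_no_degree_one`; certificates `triangleIso_v_simplex`,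
  `triangleIso_v_star`).

WHAT THIS IS NOT: cells of a bounded-rank slice of TT; nothing on TT / 19930 in general, on crux
stmt-ValiantsHypothesis-14610, or on `VP` versus `VNP`.
-/

-- layout Summits/ValiantsHypothesis/ValiantsHypothesis forces the duplicated namespace component
set_option linter.dupNamespace false

open Matrix Finset

namespace Summit.ValiantsHypothesis.ValiantsHypothesis.Theorems.BarrierLever.FiniteCheck

open Summit.ValiantsHypothesis.ValiantsHypothesis.Theorems.BarrierLever.Compression
open Summit.ValiantsHypothesis.ValiantsHypothesis.Theorems.BarrierLever.PriorityPeeling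

/-! ## 1. Degrees in a claw with three edges -/

/-- In a complex whose faces are `∅`, the singletons and three distinct pairs, the coordinate `x`
lies in `[x ∈ e₁] + [x ∈ e₂] + [x ∈ e₃] + 1` faces. -/
theorem degree_of_claw_three_edges {h r : ℕ} (u : Fin r → Finset (Fin h))
    (hu : Function.Injective u) (e₁ e₂ e₃ : Finset (Fin h)) (h12 : e₁ ≠ e₂) (h13 : e₁ ≠ e₃)
    (h23 : e₂ ≠ e₃) (c1 : e₁.card = 2) (c2 : e₂.card = 2) (c3 : e₃.card = 2)
    (himg : Finset.univ.image u = insert e₁ (insert e₂ (insert e₃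
      (insert (∅ : Finset (Fin h)) (Finset.univ.image fun a : Fin h => ({a} : Finset (Fin h)))))))
    (x : Fin h) :
    (Finset.univ.filter fun i => x ∈ u i).card =
      (if x ∈ e₁ then 1 else 0) + (if x ∈ e₂ then 1 else 0) + (if x ∈ e₃ then 1 else 0) + 1 := by
  classical
  have e : ((Finset.univ.image u).filter fun y => x ∈ y).card =
      (Finset.univ.filter fun i => x ∈ u i).card := by
    rw [Finset.filter_image, Finset.card_image_of_injective _ hu]
  rw [← e, himg]
  have hS : (insert (∅ : Finset (Fin h))
      (Finset.univ.image fun a : Fin h => ({a} : Finset (Fin h)))).filter (fun y => x ∈ y) =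
      {{x}} := by
    ext t
    simp only [Finset.mem_filter, Finset.mem_insert, Finset.mem_image, Finset.mem_univ, true_and,
      Finset.mem_singleton]
    constructor
    · rintro ⟨ht, hxt⟩
      rcases ht with rfl | ⟨a, rfl⟩
      · simp at hxt
      · rw [Finset.mem_singleton] at hxt; rw [hxt]
    · rintro rfl
      exact ⟨Or.inr ⟨x, rfl⟩, Finset.mem_singleton_self x⟩
  have hx1 : e₁ ≠ {x} := fun e' => by
    have := congrArg Finset.card e'; rw [c1, Finset.card_singleton] at this; omega
  have hx2 : e₂ ≠ {x} := fun e' => by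
    have := congrArg Finset.card e'; rw [c2, Finset.card_singleton] at this; omega
  have hx3 : e₃ ≠ {x} := fun e' => by
    have := congrArg Finset.card e'; rw [c3, Finset.card_singleton] at this; omega
  have n3 : e₃ ∉ ({{x}} : Finset (Finset (Fin h))) := by rwa [Finset.mem_singleton]
  have n2 : e₂ ∉ (insert e₃ {{x}} : Finset (Finset (Fin h))) := by
    rw [Finset.mem_insert, Finset.mem_singleton, not_or]; exact ⟨h23, hx2⟩
  have n2' : e₂ ∉ ({{x}} : Finset (Finset (Fin h))) := by rwa [Finset.mem_singleton]
  have n1a : e₁ ∉ (insert e₂ (insert e₃ {{x}}) : Finset (Finset (Fin h))) := by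
    rw [Finset.mem_insert, Finset.mem_insert, Finset.mem_singleton, not_or, not_or]
    exact ⟨h12, h13, hx1⟩
  have n1b : e₁ ∉ (insert e₂ {{x}} : Finset (Finset (Fin h))) := by
    rw [Finset.mem_insert, Finset.mem_singleton, not_or]; exact ⟨h12, hx1⟩
  have n1c : e₁ ∉ (insert e₃ {{x}} : Finset (Finset (Fin h))) := by
    rw [Finset.mem_insert, Finset.mem_singleton, not_or]; exact ⟨h13, hx1⟩
  have n1d : e₁ ∉ ({{x}} : Finset (Finset (Fin h))) := by rwa [Finset.mem_singleton]
  rw [Finset.filter_insert, Finset.filter_insert, Finset.filter_insert, hS]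
  by_cases m1 : x ∈ e₁ <;> by_cases m2 : x ∈ e₂ <;> by_cases m3 : x ∈ e₃ <;>
    simp only [m1, m2, m3, if_true, if_false]
  · rw [Finset.card_insert_of_notMem n1a, Finset.card_insert_of_notMem n2,
      Finset.card_insert_of_notMem n3, Finset.card_singleton]
  · rw [Finset.card_insert_of_notMem n1b, Finset.card_insert_of_notMem n2',
      Finset.card_singleton]
  · rw [Finset.card_insert_of_notMem n1c, Finset.card_insert_of_notMem n3, Finset.card_singleton]
  · rw [Finset.card_insert_of_notMem n1d, Finset.card_singleton]
  · rw [Finset.card_insert_of_notMem n2, Finset.card_insert_of_notMem n3, Finset.card_singleton]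
  · rw [Finset.card_insert_of_notMem n2', Finset.card_singleton]
  · rw [Finset.card_insert_of_notMem n3, Finset.card_singleton]
  · rw [Finset.card_singleton]

/-! ## 2. Transports at height 4 -/

/-- Columns inside a solid triangle `{a, b, c}` relabel onto faces of the standard solid triangle. -/
theorem cols_solid_h4 (w : Fin 8 → Finset (Fin 4)) (a b c : Fin 4) (hab : a ≠ b) (hac : a ≠ c)
    (hbc : b ≠ c) (hall : ∀ j, w j ⊆ {a, b, c}) :
    ∃ π' : Equiv.Perm (Fin 4), ∀ j, ∃ j', (w j).map π'.toEmbedding =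
      (![∅, {0}, {1}, {2}, {0, 1}, {0, 2}, {1, 2}, {0, 1, 2}] : Fin 8 → Finset (Fin 4)) j' := by
  obtain ⟨π', hπ'⟩ := Equiv.Perm.exists_extending_pair (![a, b, c] : Fin 3 → Fin 4)
    (![0, 1, 2] : Fin 3 → Fin 4) (vec3_injective a b c hab hac hbc) (by decide)
  have hπa : π' a = 0 := hπ' 0
  have hπb : π' b = 1 := hπ' 1
  have hπc : π' c = 2 := hπ' 2
  refine ⟨π', fun j => ?_⟩
  have hz : (w j).map π'.toEmbedding ∈ (({0, 1, 2} : Finset (Fin 4))).powerset := by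
    rw [Finset.mem_powerset]
    have := map_subset_three (w j) a b c π' (hall j)
    rwa [hπa, hπb, hπc] at this
  exact (by decide : ∀ z ∈ (({0, 1, 2} : Finset (Fin 4))).powerset, ∃ j' : Fin 8,
    z = (![∅, {0}, {1}, {2}, {0, 1}, {0, 2}, {1, 2}, {0, 1, 2}] : Fin 8 → Finset (Fin 4)) j') _ hz

/-- Columns of a star `∅, v₀, v₁, v₂, v₃, v₀v₁, v₀v₂, v₀v₃` relabel onto the standard star. -/
theorem cols_star_h4 (w : Fin 8 → Finset (Fin 4)) (v₀ v₁ v₂ v₃ : Fin 4) (h01 : v₀ ≠ v₁)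
    (h02 : v₀ ≠ v₂) (h03 : v₀ ≠ v₃) (h12 : v₁ ≠ v₂) (h13 : v₁ ≠ v₃) (h23 : v₂ ≠ v₃)
    (hall : ∀ j, w j = ∅ ∨ w j = {v₀} ∨ w j = {v₁} ∨ w j = {v₂} ∨ w j = {v₃} ∨ w j = {v₀, v₁} ∨
      w j = {v₀, v₂} ∨ w j = {v₀, v₃}) :
    ∃ π' : Equiv.Perm (Fin 4), ∀ j, ∃ j', (w j).map π'.toEmbedding =
      (![∅, {0}, {1}, {2}, {3}, {0, 1}, {0, 2}, {0, 3}] : Fin 8 → Finset (Fin 4)) j' := by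
  obtain ⟨π', hπ'⟩ := Equiv.Perm.exists_extending_pair (![v₀, v₁, v₂, v₃] : Fin 4 → Fin 4)
    (![0, 1, 2, 3] : Fin 4 → Fin 4) (vec4_injective v₀ v₁ v₂ v₃ h01 h02 h03 h12 h13 h23) (by decide)
  have hp0 : π' v₀ = 0 := hπ' 0
  have hp1 : π' v₁ = 1 := hπ' 1
  have hp2 : π' v₂ = 2 := hπ' 2
  have hp3 : π' v₃ = 3 := hπ' 3
  refine ⟨π', fun j => ?_⟩
  rcases hall j with e | e | e | e | e | e | e | e <;> rw [e]
  · exact ⟨0, by simp⟩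
  · exact ⟨1, by simp [hp0]⟩
  · exact ⟨2, by simp [hp1]⟩
  · exact ⟨3, by simp [hp2]⟩
  · exact ⟨4, by simp [hp3]⟩
  · exact ⟨5, by simp [Finset.map_insert, hp0, hp1]⟩
  · exact ⟨6, by simp [Finset.map_insert, hp0, hp2]⟩
  · exact ⟨7, by simp [Finset.map_insert, hp0, hp3]⟩

/-- Rows of the triangle graph plus a point `∅, a, b, c, d, {pairs in abc}` relabel onto the standard
one: every row is `∅`, a singleton, or a pair inside `{a, b, c}`. -/
theorem rows_triangleIso_h4 (u : Fin 8 → Finset (Fin 4)) (a b c : Fin 4) (hab : a ≠ b)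
    (hac : a ≠ c) (hbc : b ≠ c)
    (hall : ∀ i, (u i).card ≤ 1 ∨ ((u i).card = 2 ∧ u i ⊆ {a, b, c})) :
    ∃ π : Equiv.Perm (Fin 4), ∀ i, ∃ i', (u i).map π.toEmbedding =
      (![∅, {0}, {1}, {2}, {3}, {0, 1}, {0, 2}, {1, 2}] : Fin 8 → Finset (Fin 4)) i' := by
  classical
  obtain ⟨π, hπ⟩ := Equiv.Perm.exists_extending_pair (![a, b, c] : Fin 3 → Fin 4)
    (![0, 1, 2] : Fin 3 → Fin 4) (vec3_injective a b c hab hac hbc) (by decide)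
  have hπa : π a = 0 := hπ 0
  have hπb : π b = 1 := hπ 1
  have hπc : π c = 2 := hπ 2
  refine ⟨π, fun i => ?_⟩
  rcases hall i with h1 | ⟨h2, hsub⟩
  · rcases Nat.lt_or_ge (u i).card 1 with h0 | h1'
    · rw [Finset.card_eq_zero.mp (show (u i).card = 0 by omega)]
      exact ⟨0, by simp⟩
    · obtain ⟨x, hx⟩ := Finset.card_eq_one.mp (le_antisymm h1 h1')
      rw [hx, Finset.map_singleton]
      exact (by decide : ∀ z : Fin 4, ∃ i' : Fin 8, ({z} : Finset (Fin 4)) =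
        (![∅, {0}, {1}, {2}, {3}, {0, 1}, {0, 2}, {1, 2}] : Fin 8 → Finset (Fin 4)) i') (π x)
  · have hz : (u i).map π.toEmbedding ∈ (({0, 1, 2} : Finset (Fin 4))).powerset := by
      rw [Finset.mem_powerset]
      have := map_subset_three (u i) a b c π hsub
      rwa [hπa, hπb, hπc] at this
    have hz2 : ((u i).map π.toEmbedding).card = 2 := by rw [Finset.card_map, h2]
    exact (by decide : ∀ z ∈ (({0, 1, 2} : Finset (Fin 4))).powerset, z.card = 2 → ∃ i' : Fin 8,
      z = (![∅, {0}, {1}, {2}, {3}, {0, 1}, {0, 2}, {1, 2}] : Fin 8 → Finset (Fin 4)) i') _ hz hz2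

/-! ## 3. The star -/

/-- **Cell `(4, 8)`, star case.**  A `3`-star `u` (faces `∅`, the four singletons, `{v, q₁}`,
`{v, q₂}`, `{v, q₃}`) against an eight-face complex `w` none of whose degrees equals a degree of `u`
is GOOD: `w` is the triangle graph plus a point, and the certificate `triangleIso_v_star` applies
after the row/column swap. -/
theorem good_star_h4_r8 (u w : Fin 8 → Finset (Fin 4)) (hu : Function.Injective u)
    (hw : Function.Injective w) (hlw : IsLowerSet (Set.range w))
    (v q₁ q₂ q₃ : Fin 4) (hv1 : v ≠ q₁) (hv2 : v ≠ q₂) (hv3 : v ≠ q₃) (hq12 : q₁ ≠ q₂)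
    (hq13 : q₁ ≠ q₃) (hq23 : q₂ ≠ q₃)
    (hrows : ∀ i, u i = ∅ ∨ u i = {v} ∨ u i = {q₁} ∨ u i = {q₂} ∨ u i = {q₃} ∨ u i = {v, q₁} ∨
      u i = {v, q₂} ∨ u i = {v, q₃})
    (hdv : (Finset.univ.filter fun i => v ∈ u i).card = 4)
    (hdq : (Finset.univ.filter fun i => q₁ ∈ u i).card = 2)
    (hbig : ∃ x ∈ Finset.univ.image w, 2 ≤ x.card)
    (hclash : ∀ (a c : Fin 4), (Finset.univ.filter fun i => a ∈ u i).card ≠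
      (Finset.univ.filter fun j => c ∈ w j).card) :
    ∃ H : Matrix (Fin (4 + 4)) (Fin (4 + 4)) ℂ, (Matrix.of fun i j : Fin 8 => (H.submatrix
      (fun a : Fin 4 => if a ∈ u i then Fin.castAdd 4 a else Fin.natAdd 4 a)
      (fun c : Fin 4 => if c ∈ w j then Fin.natAdd 4 c else Fin.castAdd 4 c)).det).det ≠ 0 := by
  classical
  obtain ⟨hlow, hcard, hdegeq⟩ := image_lowerFamily w hw hlw
  obtain ⟨a, b, c, d, hab, hac, hbc, hda, hdb, hdc, hallw⟩ :=
    lowerFamily_eight_no_degree_two_four _ hlow hcard hbig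
      (fun c hc => hclash q₁ c (by rw [hdq, ← hdegeq, hc]))
      (fun c hc => hclash v c (by rw [hdv, ← hdegeq, hc]))
  -- rows of the swapped layout: w is the triangle graph plus a point
  have hwrows : ∀ j, (w j).card ≤ 1 ∨ ((w j).card = 2 ∧ w j ⊆ {a, b, c}) := by
    intro j
    rcases hallw (w j) (Finset.mem_image.mpr ⟨j, Finset.mem_univ _, rfl⟩) with
      e | e | e | e | e | e | e | e <;> rw [e]
    · left; simp
    · left; simp
    · left; simp
    · left; simp
    · left; simp
    · right
      refine ⟨Finset.card_pair hab, fun x hx => ?_⟩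
      simp only [Finset.mem_insert, Finset.mem_singleton] at hx ⊢
      rcases hx with rfl | rfl
      · exact Or.inl rfl
      · exact Or.inr (Or.inl rfl)
    · right
      refine ⟨Finset.card_pair hac, fun x hx => ?_⟩
      simp only [Finset.mem_insert, Finset.mem_singleton] at hx ⊢
      rcases hx with rfl | rfl
      · exact Or.inl rfl
      · exact Or.inr (Or.inr rfl)
    · right
      refine ⟨Finset.card_pair hbc, fun x hx => ?_⟩
      simp only [Finset.mem_insert, Finset.mem_singleton] at hx ⊢
      rcases hx with rfl | rfl
      · exact Or.inr (Or.inl rfl)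
      · exact Or.inr (Or.inr rfl)
  obtain ⟨π, hπ⟩ := rows_triangleIso_h4 w a b c hab hac hbc hwrows
  obtain ⟨π', hπ'⟩ := cols_star_h4 u v q₁ q₂ q₃ hv1 hv2 hv3 hq12 hq13 hq23 hrows
  exact tt_layout_swap 4 8 u w
    (good_of_ppDerivable_relabel w u _ _ hw hu π π' hπ hπ' triangleIso_v_star_h4_derivable)

/-! ## 4. The triangle graph plus a point -/

/-- **Cell `(4, 8)`, triangle-graph case.**  The triangle graph plus a point `u` (a vertex of
degree three, a vertex of degree one) against an eight-face complex `w` none of whose degrees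
equals a degree of `u` is GOOD: `w` is a solid triangle or a star. -/
theorem good_triangleIso_h4_r8 (u w : Fin 8 → Finset (Fin 4)) (hu : Function.Injective u)
    (hw : Function.Injective w) (hlw : IsLowerSet (Set.range w))
    (a b c : Fin 4) (hab : a ≠ b) (hac : a ≠ c) (hbc : b ≠ c)
    (hrows : ∀ i, (u i).card ≤ 1 ∨ ((u i).card = 2 ∧ u i ⊆ {a, b, c}))
    (x₃ x₁ : Fin 4) (hd3 : (Finset.univ.filter fun i => x₃ ∈ u i).card = 3)
    (hd1 : (Finset.univ.filter fun i => x₁ ∈ u i).card = 1)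
    (hclash : ∀ (a c : Fin 4), (Finset.univ.filter fun i => a ∈ u i).card ≠
      (Finset.univ.filter fun j => c ∈ w j).card) :
    ∃ H : Matrix (Fin (4 + 4)) (Fin (4 + 4)) ℂ, (Matrix.of fun i j : Fin 8 => (H.submatrix
      (fun a : Fin 4 => if a ∈ u i then Fin.castAdd 4 a else Fin.natAdd 4 a)
      (fun c : Fin 4 => if c ∈ w j then Fin.natAdd 4 c else Fin.castAdd 4 c)).det).det ≠ 0 := by
  classical
  obtain ⟨hlow, hcard, hdegeq⟩ := image_lowerFamily w hw hlw
  have hdeg1 : ∀ c : Fin 4, ((Finset.univ.image w).filter fun y => c ∈ y).card ≠ 1 :=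
    fun c hc => hclash x₁ c (by rw [hd1, ← hdegeq, hc])
  have hdeg3 : ∀ c : Fin 4, ((Finset.univ.image w).filter fun y => c ∈ y).card ≠ 3 :=
    fun c hc => hclash x₃ c (by rw [hd3, ← hdegeq, hc])
  obtain ⟨π, hπ⟩ := rows_triangleIso_h4 u a b c hab hac hbc hrows
  rcases lowerFamily_eight_no_degree_one _ hlow hcard hdeg1 with
    ⟨a', b', c', hab', hac', hbc', hall⟩ |
    ⟨v₁, v₂, v₃, v₄, h12, h13, h14, h23, h24, h34, -, h2F, h12F, h23F, hall⟩ |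
    ⟨v₀, v₁, v₂, v₃, h01, h02, h03, h12, h13, h23, -, -, -, -, -, hall⟩
  · -- solid triangle
    obtain ⟨π', hπ'⟩ := cols_solid_h4 w a' b' c' hab' hac' hbc'
      (fun j => hall _ (Finset.mem_image.mpr ⟨j, Finset.mem_univ _, rfl⟩))
    exact good_of_ppDerivable_relabel u w _ _ hu hw π π' hπ hπ' triangleIso_v_simplex_h4_derivable
  · -- a four-path has a vertex of degree three: excluded
    exfalso
    apply hdeg3 v₂
    have : ((Finset.univ.image w).filter fun y => v₂ ∈ y) = {{v₂}, {v₁, v₂}, {v₂, v₃}} := by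
      ext y
      simp only [Finset.mem_filter, Finset.mem_insert, Finset.mem_singleton]
      constructor
      · rintro ⟨hy, hvy⟩
        rcases hall y hy with rfl | rfl | rfl | rfl | rfl | rfl | rfl | rfl
        · simp at hvy
        · simp only [Finset.mem_singleton] at hvy; exact absurd hvy.symm h12
        · exact Or.inl rfl
        · simp only [Finset.mem_singleton] at hvy; exact absurd hvy h23
        · simp only [Finset.mem_singleton] at hvy; exact absurd hvy h24
        · exact Or.inr (Or.inl rfl)
        · exact Or.inr (Or.inr rfl)
        · simp only [Finset.mem_insert, Finset.mem_singleton] at hvy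
          rcases hvy with e | e
          · exact absurd e h23
          · exact absurd e h24
      · rintro (rfl | rfl | rfl)
        · exact ⟨h2F, by simp⟩
        · exact ⟨h12F, by simp⟩
        · exact ⟨h23F, by simp⟩
    rw [this, Finset.card_insert_of_notMem, Finset.card_pair]
    · intro e
      have : v₁ ∈ ({v₂, v₃} : Finset (Fin 4)) := by rw [← e]; simp
      simp only [Finset.mem_insert, Finset.mem_singleton] at this
      rcases this with e' | e'
      · exact h12 e'
      · exact h13 e'
    · simp only [Finset.mem_insert, Finset.mem_singleton, not_or]
      refine ⟨fun e => ?_, fun e => ?_⟩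
      · have : v₁ ∈ ({v₂} : Finset (Fin 4)) := by rw [e]; simp
        exact h12 (Finset.mem_singleton.mp this)
      · have : v₃ ∈ ({v₂} : Finset (Fin 4)) := by rw [e]; simp
        exact h23 (Finset.mem_singleton.mp this).symm
  · -- star
    obtain ⟨π', hπ'⟩ := cols_star_h4 w v₀ v₁ v₂ v₃ h01 h02 h03 h12 h13 h23
      (fun j => hall _ (Finset.mem_image.mpr ⟨j, Finset.mem_univ _, rfl⟩))
    exact good_of_ppDerivable_relabel u w _ _ hu hw π π' hπ hπ' triangleIso_v_star_h4_derivable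

end Summit.ValiantsHypothesis.ValiantsHypothesis.Theorems.BarrierLever.FiniteCheck
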